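import Literature.NumberTheory.Weil1964.ArchSectionThetaMajorants
import Literature.Analysis.SegalBargmann.SchwartzHeisenbergSchur
import HarnessLib

/-!
# Two Weil-covariant archimedean operators over the same symplectic element are proportional

Topic `NumberTheory/Weil1964`; namespace `Literature.NumberTheory.Weil1964`.  KERNEL MATHEMATICS ONLY: proved
theorems; no definition, no `def … : Prop` record, no axiom, no proof hole.

For `g ∈ Sp(W_𝔸)` (Gram matrix `T`, archimedean part invertible) and two topological automorphisms `A, B` of
`𝓢(X_∞)` that are Weil-covariant over `g` on the archimedean Heisenberg elements
(`A ρ_∞(a, w) = ψ(f_g) ρ_∞(g(a, w)) A`, the shape `hA` of `AdelicMetaplecticOfArchImplementer.archElt` and the conclusion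
of `AdelicMetaplecticArchCovariance.archCovariant_of_map_tmul`), **`A = c · B` for a scalar `c ≠ 0`**
(`exists_smul_of_archCovariant`): `A B⁻¹` commutes with every `ρ_∞(a, w)`, hence (the dictionary
`archModTrans = phase · rhoSD` of `ArchSchrodingerFollandDictionary` in a Folland frame `e` and the surjectivity of the
Folland coordinates) with every `rhoSD e p q`, so it is a scalar by the continuous Schur lemma on Schwartz space
(`SchwartzHeisenbergSchur.eq_smul_of_commute_rhoSD`) [Folland1989, Prop. (1.50)/(4.23) remark p. 156].

Use: the archimedean factor `A` of Weil's `r_F(δ)` (tensor stripping) versus the frame transport `e^* z e_*` of an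
element `z ∈ Mp^𝓢` over the dictionary of `δ` — the conjugations by `A` and by `e^* z e_*` then agree.

## References

* [Folland1989] G. B. Folland, *Harmonic Analysis in Phase Space*, Princeton UP 1989, Prop. (1.50), §4.2 p. 156.
* [Weil1964] A. Weil, Acta Math. 111 (1964), Chap. I n° 10 (uniqueness of implementers up to scalars).
-/

set_option autoImplicit false

noncomputable section

open MeasureTheory Complex SchwartzMap
open scoped Classical
open NumberField NumberField.mixedEmbedding IsDedekindDomain

namespace Literature.NumberTheory.Weil1964

open Literature.Analysis.SegalBargmann Literature.RepresentationTheory.HeisenbergGroup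
open Literature.NumberTheory.Automorphic

variable {F : Type} [Field F] [NumberField F] {ι : Type} [Fintype ι] [DecidableEq ι]
  (T : Matrix ι ι (AdeleRing (𝓞 F) F))

/-- `archAct 1 = id`. [cite: Weil1964, Chap. III n° 37] -/
theorem archAct_one (aw : (ι → mixedSpace F) × (ι → mixedSpace F)) : archAct T 1 aw = aw := by
  obtain ⟨a, w⟩ := aw
  simp only [archAct, OneMemClass.coe_one, LinearEquiv.coe_one, id_eq, piArch_archVec]

/-- `archAct g (archAct g⁻¹ x) = x`. [cite: Weil1964, Chap. III n° 37] -/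
theorem archAct_apply_inv (g : symplecticGroup (polar (adelicForm F ι T))) (aw : (ι → mixedSpace F) × (ι → mixedSpace F)) :
    archAct T g (archAct T g⁻¹ aw) = aw := by
  rw [← archAct_mul, mul_inv_cancel, archAct_one]

variable {σ : Type*} [Fintype σ] [DecidableEq σ]

/-- **Two Weil-covariant archimedean automorphisms over the same `g` are proportional**: `A = c · B`, `c ≠ 0`.
[cite: Folland1989, Prop. (1.50), §4.2 p. 156; Weil1964, Chap. I n° 10] -/
theorem exists_smul_of_archCovariant (e : (ι → mixedSpace F) ≃L[ℝ] (σ → ℝ)) (hT : IsUnit (archMat F ι T))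
    (g : symplecticGroup (polar (adelicForm F ι T)))
    (A B : 𝓢((ι → mixedSpace F), ℂ) ≃L[ℂ] 𝓢((ι → mixedSpace F), ℂ))
    (hA : ∀ (a w : ι → mixedSpace F) (Φ : 𝓢((ι → mixedSpace F), ℂ)),
      A (archModTrans F ι T a w Φ) =
        weilPhase T g (a, w) • archModTrans F ι T (archAct T g (a, w)).1 (archAct T g (a, w)).2 (A Φ))
    (hB : ∀ (a w : ι → mixedSpace F) (Φ : 𝓢((ι → mixedSpace F), ℂ)),
      B (archModTrans F ι T a w Φ) =
        weilPhase T g (a, w) • archModTrans F ι T (archAct T g (a, w)).1 (archAct T g (a, w)).2 (B Φ)) :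
    ∃ c : ℂ, c ≠ 0 ∧ ∀ Φ, A Φ = c • B Φ := by
  -- `C = A ∘ B⁻¹` commutes with every `ρ_∞(a', w')`
  set C : 𝓢((ι → mixedSpace F), ℂ) →L[ℂ] 𝓢((ι → mixedSpace F), ℂ) :=
    (A : 𝓢((ι → mixedSpace F), ℂ) →L[ℂ] 𝓢((ι → mixedSpace F), ℂ)).comp
      (B.symm : 𝓢((ι → mixedSpace F), ℂ) →L[ℂ] 𝓢((ι → mixedSpace F), ℂ)) with hCdef
  have hCapp : ∀ Ψ, C Ψ = A (B.symm Ψ) := fun Ψ => rfl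
  have hBinv : ∀ (a w : ι → mixedSpace F) (Ψ : 𝓢((ι → mixedSpace F), ℂ)),
      B.symm (archModTrans F ι T (archAct T g (a, w)).1 (archAct T g (a, w)).2 Ψ) =
        (weilPhase T g (a, w))⁻¹ • archModTrans F ι T a w (B.symm Ψ) := by
    intro a w Ψ
    apply B.injective
    rw [ContinuousLinearEquiv.apply_symm_apply, map_smul, hB, ContinuousLinearEquiv.apply_symm_apply, smul_smul,
      inv_mul_cancel₀ (weilPhase_ne_zero T g (a, w)), one_smul]
  have hCcomm : ∀ (a' w' : ι → mixedSpace F) (Ψ : 𝓢((ι → mixedSpace F), ℂ)),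
      C (archModTrans F ι T a' w' Ψ) = archModTrans F ι T a' w' (C Ψ) := by
    intro a' w' Ψ
    obtain ⟨a, w, haw⟩ : ∃ a w, archAct T g (a, w) = (a', w') :=
      ⟨(archAct T g⁻¹ (a', w')).1, (archAct T g⁻¹ (a', w')).2, archAct_apply_inv T g (a', w')⟩
    have h1 := hBinv a w Ψ
    have h2 := hA a w (B.symm Ψ)
    rw [haw] at h1 h2
    rw [hCapp, hCapp, h1, map_smul, h2, smul_smul, inv_mul_cancel₀ (weilPhase_ne_zero T g (a, w)), one_smul]
  -- hence with every `rhoSD e p q`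
  have hCrho : ∀ (p q : σ → ℝ) (Ψ : 𝓢((ι → mixedSpace F), ℂ)), C (rhoSD e p q Ψ) = rhoSD e p q (C Ψ) := by
    intro p q Ψ
    obtain ⟨⟨a', w'⟩, haw⟩ := (archFolland_bijective (T := T) e hT).2 (p, q)
    rw [archFolland_apply] at haw
    obtain ⟨rfl, rfl⟩ := Prod.mk.inj haw
    have h := hCcomm a' w' Ψ
    rw [archModTrans_eq_smul_rhoSD T e, archModTrans_eq_smul_rhoSD T e, map_smul] at h
    exact smul_right_injective _ (Complex.exp_ne_zero _) h
  obtain ⟨c, hc⟩ := eq_smul_of_commute_rhoSD e C hCrho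
  refine ⟨c, ?_, fun Φ => ?_⟩
  · intro h0
    set Φ₀ : 𝓢((ι → mixedSpace F), ℂ) := (schwartzTransport e).symm (hermitePi (0 : σ →₀ ℕ)) with hΦ₀def
    have hΦ₀ : Φ₀ ≠ 0 := fun h =>
      hermitePi_ne_zero (0 : σ →₀ ℕ) ((schwartzTransport e).symm.injective (by rw [← hΦ₀def, h, map_zero]))
    have h1 : C (B Φ₀) = 0 := by rw [hc, h0, zero_smul]
    rw [hCapp, ContinuousLinearEquiv.symm_apply_apply] at h1
    exact hΦ₀ (A.injective (by rw [h1, map_zero]))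
  · have h := hc (B Φ)
    rwa [hCapp, ContinuousLinearEquiv.symm_apply_apply] at h

end Literature.NumberTheory.Weil1964

end
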